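import Mathlib
import HarnessLib
import Literature.NumberTheory.Transcendental.AnalytificationImplicit

/-!
# A globally asymptotically stable polynomial vector field with no polynomial Lyapunov function
# (Ahmadi–Krstić–Parrilo, CDC 2011, Theorem 1.1)

Topic `Literature/Analysis/ODE`, namespace `Literature.Analysis.ODE.AKP2011`. Everything below is
PROVED (no named fact, no `sorry`, no new axiom). It is the tree's kernel witness for the ceiling
«a search for POLYNOMIAL (hence for sum-of-squares) Lyapunov functions is a SUFFICIENT test only»:
global asymptotic stability of a polynomial vector field does not imply the existence of a
polynomial Lyapunov function, even in the plane and at degree 2.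

SOURCE (read on the page; held text `paper:doi-10-1109-cdc-2011-6161499`, pp. 1–2).
A. A. Ahmadi, M. Krstić, P. A. Parrilo, *A globally asymptotically stable polynomial vector field
with no polynomial Lyapunov function*, Proc. 50th IEEE CDC–ECC (2011) 7579–7580
[AhmadiKrsticParrilo2011]:

> «Theorem 1.1: Consider the polynomial vector field `ẋ = −x + xy`, `ẏ = −y` (1). The origin is a
> globally asymptotically stable equilibrium point, but the system does not admit a polynomial
> Lyapunov function.»

Printed proof, p. 1: GAS via `V = ln(1 + x²) + y²`; «we can explicitly solve for the solution
`(x(t), y(t))` … starting from any initial condition: `x(t) = x(0) e^{[y(0) − y(0)e^{−t} − t]}`,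
`y(t) = y(0) e^{−t}` (2)»; p. 2: for initial conditions `(k, αk)`, «the time `t*` it takes for the
trajectory to cross the line `y = α`» gives the crossing point «`(x(t*), y(t*)) = (e^{α(k−1)}, α)`»,
and «for `V(x, y)` to be a valid Lyapunov function, it must satisfy `V(e^{α(k−1)}, α) < V(k, αk)`.
However, this inequality cannot hold for `k` large enough, since … the left hand side grows
exponentially in `k` whereas the right hand side grows only polynomially in `k`.»

WHAT IS PROVED, and how it renders the source.

* `field`, `flow` — system (1) on `ℝ²` realised as `Fin 2 → ℝ` (`z 0 = x`, `z 1 = y`) and its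
  explicit solution (2); `hasDerivAt_flow` (it solves (1) for all real `t`), `eq_flow_of_solution`
  (UNIQUENESS in the tree's flow-free solution convention `∀ t ∈ [0,T], HasDerivWithinAt X (f (X t))
  [0,T] t`, proved by two conserved quantities `y eᵗ` and `x e^{t − y₀(1 − e^{−t})}`, no Lipschitz /
  Picard–Lindelöf machinery), `norm_flow_le` (`‖z(t)‖ ≤ ‖z₀‖ e^{‖z₀‖}` for `t ≥ 0`),
  `tendsto_flow_zero`; packaged as `globallyAsymptoticallyStable` — existence of a global solution
  from every initial state, the uniform bound (hence Lyapunov stability: `‖z₀‖ e^{‖z₀‖} → 0` as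
  `z₀ → 0`) and attraction of EVERY solution. This replaces the source's `ln(1+x²) + y²` argument
  by the explicit solution the source itself prints as (2) — a shorter road in the kernel.
* `lieDeriv V` — the Lie derivative `V̇ = ∂ₓV · (−x + xy) + ∂_yV · (−y)` of a real polynomial
  `V : MvPolynomial (Fin 2) ℝ` along (1), as a polynomial; `hasDerivAt_eval_flow` (chain rule, via
  the tree's `Literature.NumberTheory.Transcendental.hasFDerivAt_eval`).
* `no_polynomial_lyapunov_of_unbounded` — the heart of Theorem 1.1 in a form STRONGER than
  printed: there is no real polynomial `V` with `V̇ ≤ 0` on the open positive quadrant whose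
  restriction to SOME horizontal line `y = α`, `α > 0`, is unbounded above towards `x → +∞`
  (positive definiteness is not used; the source needs «nontrivial dependence on y» and a generic
  `α` only to get this unboundedness, which radial unboundedness gives for every `α`).
* `no_polynomial_lyapunov_function` — Theorem 1.1, second half, with the textbook meaning of
  «polynomial Lyapunov function proving GAS»: radially unbounded and `V̇ < 0` off the origin
  (`V̇ ≤ 0` suffices and is what is assumed).
* `theorem_1_1` — both halves together.

The exponential-versus-polynomial step is made quantitative as in the source: a real polynomial
tending to `+∞` is eventually `≥ c·s` (`exists_linear_lower_of_tendsto_atTop`, from Mathlib's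
`Polynomial.tendsto_atTop_iff_leadingCoeff_nonneg` / `Polynomial.isEquivalent_atTop_lead`), a real
polynomial is `≤ B·k^D` for `k ≥ 1` (`exists_abs_eval_le_pow`), and `e^{αk}/k^D → ∞`
(Mathlib's `tendsto_exp_mul_div_rpow_atTop`).

FORMAL PRIOR ART. J. Liu, M. Fitzsimmons, arXiv:2607.16171 (2026) formalise in Lean 4 (outside
Mathlib) a SHARPER planar example (homogeneous cubic, no polynomial and no analytic Lyapunov
function) [LiuFitzsimmons2026]; nothing of either kind is in Mathlib or in this tree. The
companion barrier «nonnegative ≠ SOS» is `Literature/Algebra/Polynomial/MotzkinNotSumOfSquares.lean`.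

WHAT THIS FILE IS NOT: not a statement about LOCAL certificates — on compact sets locally
exponentially stable polynomial fields DO admit polynomial Lyapunov functions (Peet 2009, cited by
the source as [3]); system (1) is locally exponentially stable (linearisation `−I`) and the
obstruction is «fast growth arbitrarily far away from the origin» (source, p. 2). No claim about
rational versus polynomial versus analytic Lyapunov functions beyond the polynomial case is made.
-/

noncomputable section

open MvPolynomial Set Filter Real
open scoped Topology

namespace Literature.Analysis.ODE

namespace AKP2011

/-! ### The system and its explicit solution -/

/-- The vector field (1) of Ahmadi–Krstić–Parrilo, `ẋ = −x + xy`, `ẏ = −y`, on `ℝ² = (Fin 2 → ℝ)`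
with `z 0 = x`, `z 1 = y`. [cite: AhmadiKrsticParrilo2011, Thm 1.1 eq. (1)] -/
def field (z : Fin 2 → ℝ) : Fin 2 → ℝ := ![-z 0 + z 0 * z 1, -z 1]

/-- First component of the field: `−x + xy`. [cite: AhmadiKrsticParrilo2011, Thm 1.1 eq. (1)] -/
@[simp] theorem field_apply_zero (z : Fin 2 → ℝ) : field z 0 = -z 0 + z 0 * z 1 := rfl

/-- Second component of the field: `−y`. [cite: AhmadiKrsticParrilo2011, Thm 1.1 eq. (1)] -/
@[simp] theorem field_apply_one (z : Fin 2 → ℝ) : field z 1 = -z 1 := rfl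

/-- The origin is an equilibrium of (1). [cite: AhmadiKrsticParrilo2011, Thm 1.1] -/
theorem field_zero : field 0 = 0 := by
  ext i; fin_cases i <;> simp

/-- The explicit solution (2) of (1) from the initial state `z₀ = (x₀, y₀)`:
`x(t) = x₀ e^{y₀ − y₀e^{−t} − t}`, `y(t) = y₀ e^{−t}`. [cite: AhmadiKrsticParrilo2011, eq. (2)] -/
def flow (z₀ : Fin 2 → ℝ) (t : ℝ) : Fin 2 → ℝ :=
  ![z₀ 0 * exp (z₀ 1 * (1 - exp (-t)) - t), z₀ 1 * exp (-t)]

/-- First component of the explicit solution. [cite: AhmadiKrsticParrilo2011, eq. (2)] -/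
@[simp] theorem flow_apply_zero (z₀ : Fin 2 → ℝ) (t : ℝ) :
    flow z₀ t 0 = z₀ 0 * exp (z₀ 1 * (1 - exp (-t)) - t) := rfl

/-- Second component of the explicit solution. [cite: AhmadiKrsticParrilo2011, eq. (2)] -/
@[simp] theorem flow_apply_one (z₀ : Fin 2 → ℝ) (t : ℝ) : flow z₀ t 1 = z₀ 1 * exp (-t) := rfl

/-- The explicit solution starts at `z₀`. [cite: AhmadiKrsticParrilo2011, eq. (2)] -/
@[simp] theorem flow_zero (z₀ : Fin 2 → ℝ) : flow z₀ 0 = z₀ := by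
  ext i; fin_cases i <;> simp

/-- **(2) solves (1)**: `t ↦ flow z₀ t` has derivative `field (flow z₀ t)` at every real `t`.
[cite: AhmadiKrsticParrilo2011, eq. (2)] -/
theorem hasDerivAt_flow (z₀ : Fin 2 → ℝ) (t : ℝ) : HasDerivAt (flow z₀) (field (flow z₀ t)) t := by
  have he : HasDerivAt (fun s : ℝ => exp (-s)) (-exp (-t)) t :=
    (hasDerivAt_neg t).exp.congr_deriv (by ring)
  -- `x(t) = x₀ e^{u(t)}`, `u = y₀ (1 − e^{−t}) − t`, `u' = y₀ e^{−t} − 1`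
  have hu : HasDerivAt (fun s : ℝ => z₀ 1 * (1 - exp (-s)) - s) (z₀ 1 * exp (-t) - 1) t := by
    have h2 := (((hasDerivAt_const t (1 : ℝ)).sub he).const_mul (z₀ 1)).sub (hasDerivAt_id t)
    exact h2.congr_deriv (by ring)
  have hx : HasDerivAt (fun s : ℝ => z₀ 0 * exp (z₀ 1 * (1 - exp (-s)) - s))
      (field (flow z₀ t) 0) t := by
    refine (((Real.hasDerivAt_exp _).comp t hu).const_mul (z₀ 0)).congr_deriv ?_
    rw [field_apply_zero, flow_apply_zero, flow_apply_one]
    ring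
  have hy : HasDerivAt (fun s : ℝ => z₀ 1 * exp (-s)) (field (flow z₀ t) 1) t := by
    refine (he.const_mul (z₀ 1)).congr_deriv ?_
    rw [field_apply_one, flow_apply_one]
    ring
  rw [hasDerivAt_pi]
  intro i
  fin_cases i
  · exact hx
  · exact hy

/-- The explicit solution in the tree's solution convention (derivatives within `[0, T]`).
[cite: AhmadiKrsticParrilo2011, eq. (2)] -/
theorem flow_isSolution (z₀ : Fin 2 → ℝ) (T : ℝ) :
    ∀ t ∈ Icc 0 T, HasDerivWithinAt (flow z₀) (field (flow z₀ t)) (Icc 0 T) t :=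
  fun t _ => (hasDerivAt_flow z₀ t).hasDerivWithinAt

/-! ### Uniqueness: every solution is the explicit one -/

/-- From a derivative within `[0, T]` at `t < T` to a right derivative at `t`. [folklore] -/
private theorem hasDerivWithinAt_Ici_of_Icc {g : ℝ → ℝ} {g' t T : ℝ} (ht : t ∈ Ico 0 T)
    (h : HasDerivWithinAt g g' (Icc 0 T) t) : HasDerivWithinAt g g' (Ici t) t :=
  h.mono_of_mem_nhdsWithin (mem_of_superset (Icc_mem_nhdsGE ht.2) (Icc_subset_Icc ht.1 le_rfl))

/-- **Uniqueness of solutions of (1)**: a solution on `[0, T]` (derivatives within `[0, T]`) is the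
explicit solution (2) from its initial state — via the conserved quantities `y(t) eᵗ` and
`x(t) e^{t − y₀(1 − e^{−t})}`; no Lipschitz / Picard–Lindelöf machinery is needed.
[cite: AhmadiKrsticParrilo2011, eq. (2)] -/
theorem eq_flow_of_solution {X : ℝ → Fin 2 → ℝ} {T : ℝ}
    (hX : ∀ t ∈ Icc 0 T, HasDerivWithinAt X (field (X t)) (Icc 0 T) t) :
    ∀ t ∈ Icc 0 T, X t = flow (X 0) t := by
  -- continuity of the components on `[0, T]`
  have hcont : ∀ i, ContinuousOn (fun s => X s i) (Icc 0 T) := fun i s hs =>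
    ((hasDerivWithinAt_pi.1 (hX s hs)) i).continuousWithinAt
  -- (a) `y(t) eᵗ` is constant
  have hy : ∀ t ∈ Icc 0 T, X t 1 = X 0 1 * exp (-t) := by
    have hg : ∀ t ∈ Icc 0 T, X t 1 * exp t = X 0 1 * exp 0 := by
      refine constant_of_has_deriv_right_zero ((hcont 1).mul Real.continuous_exp.continuousOn) ?_
      intro t ht
      have h1 : HasDerivWithinAt (fun s => X s 1) (field (X t) 1) (Icc 0 T) t :=
        (hasDerivWithinAt_pi.1 (hX t (Ico_subset_Icc_self ht))) 1
      have h2 := (h1.mul (Real.hasDerivAt_exp t).hasDerivWithinAt).congr_deriv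
        (g' := 0) (by rw [field_apply_one]; ring)
      exact hasDerivWithinAt_Ici_of_Icc ht h2
    intro t ht
    have h := hg t ht
    rw [Real.exp_zero, mul_one] at h
    calc X t 1 = X t 1 * exp t * exp (-t) := by
          rw [mul_assoc, ← Real.exp_add, add_neg_cancel, Real.exp_zero, mul_one]
      _ = X 0 1 * exp (-t) := by rw [h]
  -- (b) `x(t) e^{t − y₀(1 − e^{−t})}` is constant
  have hx : ∀ t ∈ Icc 0 T, X t 0 = X 0 0 * exp (X 0 1 * (1 - exp (-t)) - t) := by
    have hE : ∀ t, HasDerivAt (fun s : ℝ => exp (s - X 0 1 * (1 - exp (-s))))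
        (exp (t - X 0 1 * (1 - exp (-t))) * (1 - X 0 1 * exp (-t))) t := by
      intro t
      have he : HasDerivAt (fun s : ℝ => exp (-s)) (-exp (-t)) t :=
        (hasDerivAt_neg t).exp.congr_deriv (by ring)
      have h2 : HasDerivAt (fun s : ℝ => s - X 0 1 * (1 - exp (-s))) (1 - X 0 1 * exp (-t)) t :=
        ((hasDerivAt_id t).sub (((hasDerivAt_const t (1 : ℝ)).sub he).const_mul (X 0 1))).congr_deriv
          (by ring)
      exact (Real.hasDerivAt_exp _).comp t h2
    have hg : ∀ t ∈ Icc 0 T, X t 0 * exp (t - X 0 1 * (1 - exp (-t))) =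
        X 0 0 * exp (0 - X 0 1 * (1 - exp (-0))) := by
      refine constant_of_has_deriv_right_zero
        ((hcont 0).mul fun s _ => (hE s).continuousAt.continuousWithinAt) ?_
      intro t ht
      have h1 : HasDerivWithinAt (fun s => X s 0) (field (X t) 0) (Icc 0 T) t :=
        (hasDerivWithinAt_pi.1 (hX t (Ico_subset_Icc_self ht))) 0
      have hyt : X t 1 = X 0 1 * exp (-t) := hy t (Ico_subset_Icc_self ht)
      have h2 := (h1.mul (hE t).hasDerivWithinAt).congr_deriv (g' := 0)
        (by rw [field_apply_zero, hyt]; ring)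
      exact hasDerivWithinAt_Ici_of_Icc ht h2
    intro t ht
    have h := hg t ht
    rw [neg_zero, Real.exp_zero, sub_self, mul_zero, sub_zero, Real.exp_zero, mul_one] at h
    calc X t 0 = X t 0 * exp (t - X 0 1 * (1 - exp (-t))) * exp (-(t - X 0 1 * (1 - exp (-t)))) := by
          rw [mul_assoc, ← Real.exp_add, add_neg_cancel, Real.exp_zero, mul_one]
      _ = X 0 0 * exp (X 0 1 * (1 - exp (-t)) - t) := by rw [h, neg_sub]
  intro t ht
  funext i
  fin_cases i
  · exact hx t ht
  · exact hy t ht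

/-! ### Global asymptotic stability -/

/-- **Uniform bound**: for `t ≥ 0`, `‖z(t)‖ ≤ ‖z₀‖ · e^{‖z₀‖}` (sup norm on `ℝ²`).
[cite: AhmadiKrsticParrilo2011, Thm 1.1] -/
theorem norm_flow_le (z₀ : Fin 2 → ℝ) {t : ℝ} (ht : 0 ≤ t) : ‖flow z₀ t‖ ≤ ‖z₀‖ * exp ‖z₀‖ := by
  have hn : 0 ≤ ‖z₀‖ := norm_nonneg _
  have h0 : |z₀ 0| ≤ ‖z₀‖ := by simpa only [Real.norm_eq_abs] using norm_le_pi_norm z₀ 0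
  have h1 : |z₀ 1| ≤ ‖z₀‖ := by simpa only [Real.norm_eq_abs] using norm_le_pi_norm z₀ 1
  have hexp1 : 1 ≤ exp ‖z₀‖ := Real.one_le_exp hn
  have het : exp (-t) ≤ 1 := by rw [Real.exp_le_one_iff]; linarith
  have hA : |flow z₀ t 0| ≤ ‖z₀‖ * exp ‖z₀‖ := by
    rw [flow_apply_zero, abs_mul, Real.abs_exp]
    have hle : exp (z₀ 1 * (1 - exp (-t)) - t) ≤ exp ‖z₀‖ := by
      refine Real.exp_le_exp.2 ?_
      have he : 0 ≤ 1 - exp (-t) := by linarith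
      have he1 : 1 - exp (-t) ≤ 1 := by linarith [Real.exp_pos (-t)]
      have h2 : z₀ 1 * (1 - exp (-t)) ≤ |z₀ 1| * 1 :=
        (mul_le_mul_of_nonneg_right (le_abs_self _) he).trans
          (mul_le_mul_of_nonneg_left he1 (abs_nonneg _))
      linarith
    exact mul_le_mul h0 hle (Real.exp_pos _).le hn
  have hB : |flow z₀ t 1| ≤ ‖z₀‖ * exp ‖z₀‖ := by
    rw [flow_apply_one, abs_mul, Real.abs_exp]
    calc |z₀ 1| * exp (-t) ≤ ‖z₀‖ * 1 := mul_le_mul h1 het (Real.exp_pos _).le hn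
      _ ≤ ‖z₀‖ * exp ‖z₀‖ := by rw [mul_one]; exact le_mul_of_one_le_right hn hexp1
  rw [pi_norm_le_iff_of_nonneg (by positivity), Fin.forall_fin_two, Real.norm_eq_abs,
    Real.norm_eq_abs]
  exact ⟨hA, hB⟩

/-- **Attraction**: every explicit solution tends to the origin. [cite: AhmadiKrsticParrilo2011, Thm 1.1] -/
theorem tendsto_flow_zero (z₀ : Fin 2 → ℝ) : Tendsto (flow z₀) atTop (𝓝 0) := by
  have hA : Tendsto (fun t => flow z₀ t 0) atTop (𝓝 0) := by
    have hexp : Tendsto (fun t : ℝ => exp (z₀ 1 * (1 - exp (-t)) - t)) atTop (𝓝 0) := by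
      refine Real.tendsto_exp_atBot.comp ?_
      have h1 : Tendsto (fun t : ℝ => z₀ 1 * (1 - exp (-t))) atTop (𝓝 (z₀ 1 * (1 - 0))) :=
        (tendsto_const_nhds.sub Real.tendsto_exp_neg_atTop_nhds_zero).const_mul _
      have h2 := h1.add_atBot tendsto_neg_atTop_atBot
      simpa only [sub_eq_add_neg] using h2
    simpa only [flow_apply_zero, mul_zero] using hexp.const_mul (z₀ 0)
  have hB : Tendsto (fun t => flow z₀ t 1) atTop (𝓝 0) := by
    simpa only [flow_apply_one, mul_zero] using Real.tendsto_exp_neg_atTop_nhds_zero.const_mul (z₀ 1)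
  rw [tendsto_pi_nhds, Fin.forall_fin_two]
  exact ⟨hA, hB⟩

/-- **Theorem 1.1, first half (GAS), in the tree's flow-free convention.** (i) From every initial
state there is a global solution of (1); (ii) every solution on `[0, T]` obeys
`‖X t‖ ≤ ‖X 0‖ e^{‖X 0‖}` (so the origin is stable: the bound tends to `0` with `‖X 0‖`);
(iii) every global solution tends to the origin. [cite: AhmadiKrsticParrilo2011, Thm 1.1] -/
theorem globallyAsymptoticallyStable :
    (∀ z₀ : Fin 2 → ℝ, ∃ X : ℝ → Fin 2 → ℝ, X 0 = z₀ ∧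
        ∀ T, ∀ t ∈ Icc 0 T, HasDerivWithinAt X (field (X t)) (Icc 0 T) t) ∧
    (∀ (X : ℝ → Fin 2 → ℝ) (T : ℝ), (∀ t ∈ Icc 0 T, HasDerivWithinAt X (field (X t)) (Icc 0 T) t) →
        ∀ t ∈ Icc 0 T, ‖X t‖ ≤ ‖X 0‖ * exp ‖X 0‖) ∧
    (∀ X : ℝ → Fin 2 → ℝ, (∀ T, ∀ t ∈ Icc 0 T, HasDerivWithinAt X (field (X t)) (Icc 0 T) t) →
        Tendsto X atTop (𝓝 0)) := by
  refine ⟨fun z₀ => ⟨flow z₀, flow_zero z₀, flow_isSolution z₀⟩, fun X T hX t ht => ?_,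
    fun X hX => ?_⟩
  · rw [eq_flow_of_solution hX t ht]
    exact norm_flow_le (X 0) ht.1
  · refine (tendsto_flow_zero (X 0)).congr' ?_
    filter_upwards [eventually_ge_atTop (0 : ℝ)] with t ht
    exact (eq_flow_of_solution (hX t) t ⟨ht, le_rfl⟩).symm

/-- **Stability of the origin in the ε–δ sense** (consequence of the uniform bound): for every
`ε > 0` there is `δ > 0` such that every solution on `[0, T]` starting in the `δ`-ball stays in the
`ε`-ball. [cite: AhmadiKrsticParrilo2011, Thm 1.1] -/
theorem stable_origin {ε : ℝ} (hε : 0 < ε) :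
    ∃ δ > 0, ∀ (X : ℝ → Fin 2 → ℝ) (T : ℝ),
      (∀ t ∈ Icc 0 T, HasDerivWithinAt X (field (X t)) (Icc 0 T) t) → ‖X 0‖ < δ →
        ∀ t ∈ Icc 0 T, ‖X t‖ < ε := by
  refine ⟨min 1 (ε / exp 1), lt_min one_pos (div_pos hε (Real.exp_pos 1)), fun X T hX h0 t ht => ?_⟩
  have h1 : ‖X 0‖ < 1 := lt_of_lt_of_le h0 (min_le_left _ _)
  have h2 : ‖X 0‖ < ε / exp 1 := lt_of_lt_of_le h0 (min_le_right _ _)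
  have hle := globallyAsymptoticallyStable.2.1 X T hX t ht
  have hexp : exp ‖X 0‖ ≤ exp 1 := Real.exp_le_exp.2 h1.le
  have h3 : ‖X 0‖ * exp ‖X 0‖ ≤ ‖X 0‖ * exp 1 := mul_le_mul_of_nonneg_left hexp (norm_nonneg _)
  have h4 : ‖X 0‖ * exp 1 < ε := (lt_div_iff₀ (Real.exp_pos 1)).mp h2
  linarith

/-! ### Polynomial Lyapunov candidates and their Lie derivative -/

/-- The Lie derivative of a real polynomial `V(x, y)` along (1), as a polynomial:
`V̇ = ∂ₓV · (−x + xy) + ∂_yV · (−y)`. [cite: AhmadiKrsticParrilo2011, Thm 1.1 (proof, «V̇ = ∂V/∂x ẋ + ∂V/∂y ẏ»)] -/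
def lieDeriv (V : MvPolynomial (Fin 2) ℝ) : MvPolynomial (Fin 2) ℝ :=
  pderiv 0 V * (-X 0 + X 0 * X 1) + pderiv 1 V * (-X 1)

/-- `V̇(z) = Σᵢ ∂ᵢV(z) fᵢ(z)`. [cite: AhmadiKrsticParrilo2011, Thm 1.1 (proof)] -/
theorem eval_lieDeriv (V : MvPolynomial (Fin 2) ℝ) (z : Fin 2 → ℝ) :
    eval z (lieDeriv V) = eval z (pderiv 0 V) * field z 0 + eval z (pderiv 1 V) * field z 1 := by
  simp only [lieDeriv, map_add, map_mul, map_neg, eval_X, field_apply_zero, field_apply_one]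

/-- **Chain rule along (2)**: `d/dt V(z(t)) = V̇(z(t))`. [cite: AhmadiKrsticParrilo2011, Thm 1.1 (proof)] -/
theorem hasDerivAt_eval_flow (V : MvPolynomial (Fin 2) ℝ) (z₀ : Fin 2 → ℝ) (t : ℝ) :
    HasDerivAt (fun s => eval (flow z₀ s) V) (eval (flow z₀ t) (lieDeriv V)) t := by
  have h := (Literature.NumberTheory.Transcendental.hasFDerivAt_eval V (flow z₀ t)).comp_hasDerivAt
    t (hasDerivAt_flow z₀ t)
  refine h.congr_deriv ?_
  simp only [Fin.sum_univ_two, eval_lieDeriv, add_apply, smul_apply, ContinuousLinearMap.proj_apply,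
    smul_eq_mul]

/-- Along a trajectory of (2) inside a region where `V̇ ≤ 0`, `t ↦ V(z(t))` is non-increasing
(here: the trajectory stays where the hypothesis holds for ALL real `t`).
[cite: AhmadiKrsticParrilo2011, Thm 1.1 (proof, «V(x(t*), y(t*)) < V(x(0), y(0))»)] -/
theorem antitone_eval_flow (V : MvPolynomial (Fin 2) ℝ) (z₀ : Fin 2 → ℝ)
    (hV : ∀ t : ℝ, eval (flow z₀ t) (lieDeriv V) ≤ 0) : Antitone fun s => eval (flow z₀ s) V :=
  antitone_of_deriv_nonpos (fun t => (hasDerivAt_eval_flow V z₀ t).differentiableAt) fun t => by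
    rw [(hasDerivAt_eval_flow V z₀ t).deriv]; exact hV t

/-- **The crossing point**: the trajectory from `(k, αk)`, `k > 0`, is at `(e^{α(k−1)}, α)` at time
`t* = ln k`. [cite: AhmadiKrsticParrilo2011, Thm 1.1 (proof, «(x(t*), y(t*)) = (e^{α(k−1)}, α)»)] -/
theorem flow_log (α : ℝ) {k : ℝ} (hk : 0 < k) :
    flow ![k, α * k] (Real.log k) = ![exp (α * (k - 1)), α] := by
  have hexp : exp (-Real.log k) = k⁻¹ := by rw [Real.exp_neg, Real.exp_log hk]
  have hk' : k ≠ 0 := hk.ne'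
  have h0 : flow ![k, α * k] (Real.log k) 0 = exp (α * (k - 1)) := by
    rw [flow_apply_zero, Matrix.cons_val_zero, Matrix.cons_val_one, Matrix.cons_val_zero, hexp,
      show α * k * (1 - k⁻¹) - Real.log k = α * (k - 1) + -Real.log k by field_simp; ring,
      Real.exp_add, hexp]
    field_simp
  have h1 : flow ![k, α * k] (Real.log k) 1 = α := by
    rw [flow_apply_one, Matrix.cons_val_one, Matrix.cons_val_zero, hexp]
    field_simp
  funext i
  fin_cases i
  · exact h0
  · exact h1

/-- **The decisive inequality** (source: «`V(e^{α(k−1)}, α) < V(k, αk)` … must [hold]», here with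
`≤` from `V̇ ≤ 0`): if `V̇ ≤ 0` on the open positive quadrant then for every `k ≥ 1`,
`V(e^{α(k−1)}, α) ≤ V(k, αk)`. [cite: AhmadiKrsticParrilo2011, Thm 1.1 (proof)] -/
theorem eval_crossing_le (V : MvPolynomial (Fin 2) ℝ) {α : ℝ} (hα : 0 < α)
    (hdec : ∀ z : Fin 2 → ℝ, 0 < z 0 → 0 < z 1 → eval z (lieDeriv V) ≤ 0) {k : ℝ} (hk : 1 ≤ k) :
    eval ![exp (α * (k - 1)), α] V ≤ eval ![k, α * k] V := by
  have hk0 : 0 < k := lt_of_lt_of_le one_pos hk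
  have hquad : ∀ t : ℝ, eval (flow ![k, α * k] t) (lieDeriv V) ≤ 0 := by
    intro t
    refine hdec _ ?_ ?_
    · rw [flow_apply_zero, Matrix.cons_val_zero]
      exact mul_pos hk0 (Real.exp_pos _)
    · rw [flow_apply_one, Matrix.cons_val_one, Matrix.cons_val_zero]
      exact mul_pos (mul_pos hα hk0) (Real.exp_pos _)
  have hmono : eval (flow ![k, α * k] (Real.log k)) V ≤ eval (flow ![k, α * k] 0) V :=
    antitone_eval_flow V _ hquad (Real.log_nonneg hk)
  rwa [flow_zero, flow_log α hk0] at hmono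

/-! ### Growth lemmas for real polynomials in one variable -/

/-- A real polynomial is `O(k^{deg})` for `k ≥ 1`: `|Q(k)| ≤ B k^D`. [folklore] -/
private theorem exists_abs_eval_le_pow (Q : Polynomial ℝ) :
    ∃ B : ℝ, 0 ≤ B ∧ ∀ k : ℝ, 1 ≤ k → |Q.eval k| ≤ B * k ^ Q.natDegree := by
  refine ⟨∑ i ∈ Finset.range (Q.natDegree + 1), |Q.coeff i|,
    Finset.sum_nonneg fun i _ => abs_nonneg _, fun k hk => ?_⟩
  have hk0 : (0 : ℝ) ≤ k := by linarith
  rw [Polynomial.eval_eq_sum_range, Finset.sum_mul]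
  refine (Finset.abs_sum_le_sum_abs _ _).trans (Finset.sum_le_sum fun i hi => ?_)
  rw [abs_mul, abs_of_nonneg (pow_nonneg hk0 i)]
  refine mul_le_mul_of_nonneg_left ?_ (abs_nonneg _)
  exact pow_le_pow_right₀ hk (Nat.lt_succ_iff.mp (Finset.mem_range.mp hi))

/-- A real polynomial tending to `+∞` is eventually at least linear: `c·s ≤ P(s)` for some
`c > 0`. [folklore] -/
private theorem exists_linear_lower_of_tendsto_atTop (P : Polynomial ℝ)
    (hP : Tendsto (fun s => P.eval s) atTop atTop) :
    ∃ c : ℝ, 0 < c ∧ ∀ᶠ s in atTop, c * s ≤ P.eval s := by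
  obtain ⟨hdeg, hlead⟩ := (Polynomial.tendsto_atTop_iff_leadingCoeff_nonneg P).mp hP
  have hP0 : P ≠ 0 := by rintro rfl; simp at hdeg
  have hlc : 0 < P.leadingCoeff := lt_of_le_of_ne hlead (Ne.symm (Polynomial.leadingCoeff_ne_zero.mpr hP0))
  have hnd : 1 ≤ P.natDegree := by
    have := Polynomial.natDegree_pos_iff_degree_pos.mpr hdeg
    omega
  have hequiv := Polynomial.isEquivalent_atTop_lead P
  have hbound := hequiv.isLittleO.bound (show (0 : ℝ) < 1 / 2 by norm_num)
  refine ⟨P.leadingCoeff / 2, by positivity, ?_⟩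
  filter_upwards [hbound, eventually_ge_atTop (1 : ℝ)] with s hs hs1
  have hsd : s ≤ s ^ P.natDegree := by
    calc s = s ^ 1 := (pow_one s).symm
      _ ≤ s ^ P.natDegree := pow_le_pow_right₀ hs1 hnd
  have hpow : 0 ≤ s ^ P.natDegree := pow_nonneg (by linarith) _
  simp only [Pi.sub_apply, Real.norm_eq_abs] at hs
  rw [abs_of_nonneg (mul_nonneg hlc.le hpow)] at hs
  have h1 : P.leadingCoeff * s ^ P.natDegree - P.eval s ≤ 1 / 2 * (P.leadingCoeff * s ^ P.natDegree) :=
    (le_abs_self _).trans (by rwa [abs_sub_comm] at hs)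
  have h2 : P.leadingCoeff / 2 * s ≤ P.leadingCoeff / 2 * s ^ P.natDegree :=
    mul_le_mul_of_nonneg_left hsd (by positivity)
  linarith

/-! ### No polynomial Lyapunov function -/

/-- The univariate polynomial `s ↦ V(s, α)` (restriction of `V` to the line `y = α`). [folklore] -/
private def restrictLine (V : MvPolynomial (Fin 2) ℝ) (α : ℝ) : Polynomial ℝ :=
  MvPolynomial.aeval ![Polynomial.X, Polynomial.C α] V

/-- The univariate polynomial `k ↦ V(k, αk)` (restriction of `V` to the ray `y = αx`). [folklore] -/
private def restrictRay (V : MvPolynomial (Fin 2) ℝ) (α : ℝ) : Polynomial ℝ :=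
  MvPolynomial.aeval ![Polynomial.X, Polynomial.C α * Polynomial.X] V

/-- Evaluating an `aeval`-substitution of univariate polynomials at `s` is evaluating `V` at the
substituted values. [folklore] -/
private theorem eval_aeval_fin_two (V : MvPolynomial (Fin 2) ℝ) (g : Fin 2 → Polynomial ℝ)
    (s : ℝ) : (MvPolynomial.aeval g V).eval s = eval ![(g 0).eval s, (g 1).eval s] V := by
  have h := MvPolynomial.map_aeval g (Polynomial.evalRingHom s) V
  have hcomp : (Polynomial.evalRingHom s).comp (algebraMap ℝ (Polynomial ℝ)) = RingHom.id ℝ := by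
    ext a
    simp
  rw [hcomp, Polynomial.coe_evalRingHom] at h
  have hg : (fun i => (g i).eval s) = ![(g 0).eval s, (g 1).eval s] := by
    funext i
    fin_cases i <;> rfl
  rw [h, ← hg]
  rfl

/-- `restrictLine V α` evaluates to `V(s, α)`. [folklore] -/
private theorem eval_restrictLine (V : MvPolynomial (Fin 2) ℝ) (α s : ℝ) :
    (restrictLine V α).eval s = eval ![s, α] V := by
  rw [restrictLine, eval_aeval_fin_two]; simp

/-- `restrictRay V α` evaluates to `V(k, αk)`. [folklore] -/
private theorem eval_restrictRay (V : MvPolynomial (Fin 2) ℝ) (α k : ℝ) :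
    (restrictRay V α).eval k = eval ![k, α * k] V := by
  rw [restrictRay, eval_aeval_fin_two]; simp

/-- **Theorem 1.1, the obstruction, in a form stronger than printed.** There is no real polynomial
`V(x, y)` whose Lie derivative along (1) is `≤ 0` on the open positive quadrant and whose
restriction to some horizontal line `y = α` (`α > 0`) is unbounded above as `x → +∞`: along the
trajectory from `(k, αk)` such a `V` would satisfy `V(e^{α(k−1)}, α) ≤ V(k, αk)`, and the left side
grows exponentially in `k` while the right side is a polynomial in `k`.
[cite: AhmadiKrsticParrilo2011, Thm 1.1 (proof, p. 2)] -/
theorem no_polynomial_lyapunov_of_unbounded (V : MvPolynomial (Fin 2) ℝ) {α : ℝ} (hα : 0 < α)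
    (hdec : ∀ z : Fin 2 → ℝ, 0 < z 0 → 0 < z 1 → eval z (lieDeriv V) ≤ 0)
    (hunb : Tendsto (fun s : ℝ => eval ![s, α] V) atTop atTop) : False := by
  -- the two univariate polynomials
  set P := restrictLine V α with hPdef
  set Q := restrictRay V α with hQdef
  have hP : Tendsto (fun s => P.eval s) atTop atTop := by
    simpa only [hPdef, eval_restrictLine] using hunb
  obtain ⟨c, hc, hclow⟩ := exists_linear_lower_of_tendsto_atTop P hP
  obtain ⟨B, hB, hQup⟩ := exists_abs_eval_le_pow Q
  set D := Q.natDegree with hD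
  -- the crossing abscissa `e^{α(k−1)}` tends to `+∞` with `k`
  have hcross : Tendsto (fun k : ℝ => exp (α * (k - 1))) atTop atTop := by
    refine Real.tendsto_exp_atTop.comp ?_
    have h1 : Tendsto (fun k : ℝ => k - 1) atTop atTop := by
      simpa [sub_eq_add_neg] using tendsto_atTop_add_const_right atTop (-1 : ℝ) tendsto_id
    exact h1.const_mul_atTop hα
  -- eventually in `k`: `c e^{α(k−1)} ≤ V(e^{α(k−1)}, α) ≤ V(k, αk) ≤ B k^D`
  have hev : ∀ᶠ k : ℝ in atTop, exp (α * k) / k ^ D ≤ B * exp α / c := by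
    filter_upwards [hcross.eventually hclow, eventually_ge_atTop (1 : ℝ)] with k hk hk1
    have hkpos : 0 < k := by linarith
    have hkD : 0 < k ^ D := pow_pos hkpos D
    have h1 : c * exp (α * (k - 1)) ≤ eval ![exp (α * (k - 1)), α] V := by
      simpa only [hPdef, eval_restrictLine] using hk
    have h2 : eval ![exp (α * (k - 1)), α] V ≤ eval ![k, α * k] V := eval_crossing_le V hα hdec hk1
    have h3 : eval ![k, α * k] V ≤ B * k ^ D := by
      have := hQup k hk1
      rw [hQdef, eval_restrictRay] at this
      exact (le_abs_self _).trans this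
    have h4 : c * exp (α * (k - 1)) ≤ B * k ^ D := h1.trans (h2.trans h3)
    have h5 : exp (α * k) = exp (α * (k - 1)) * exp α := by rw [← Real.exp_add]; ring_nf
    have h6 := mul_le_mul_of_nonneg_left h4 (Real.exp_pos α).le
    rw [div_le_div_iff₀ hkD hc, h5]
    linarith [h6]
  -- but `e^{αk}/k^D → +∞`
  have hlim : Tendsto (fun k : ℝ => exp (α * k) / k ^ D) atTop atTop := by
    have h := tendsto_exp_mul_div_rpow_atTop (D : ℝ) α hα
    refine h.congr' ?_
    filter_upwards [eventually_ge_atTop (0 : ℝ)] with k hk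
    rw [Real.rpow_natCast]
  obtain ⟨k, hk1, hk2⟩ := (hev.and (hlim.eventually_gt_atTop (B * exp α / c))).exists
  exact absurd hk1 (not_le.mpr hk2)

/-- **Theorem 1.1, second half, as printed (and slightly more):** system (1) admits no polynomial
Lyapunov function proving global asymptotic stability — no real polynomial `V` is radially
unbounded (`V(z) → +∞` as `‖z‖ → ∞`) with Lie derivative `V̇ ≤ 0` off the origin (the source asks
`V̇ < 0` and positive definiteness; neither strictness nor definiteness is needed for the
contradiction). [cite: AhmadiKrsticParrilo2011, Thm 1.1] -/
theorem no_polynomial_lyapunov_function (V : MvPolynomial (Fin 2) ℝ)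
    (hrad : ∀ M : ℝ, ∃ R : ℝ, ∀ z : Fin 2 → ℝ, R ≤ ‖z‖ → M ≤ eval z V)
    (hdec : ∀ z : Fin 2 → ℝ, z ≠ 0 → eval z (lieDeriv V) ≤ 0) : False := by
  refine no_polynomial_lyapunov_of_unbounded V one_pos (fun z hz0 _ => hdec z ?_) ?_
  · intro h
    have : z 0 = 0 := by simp [h]
    exact hz0.ne' this
  · rw [tendsto_atTop_atTop]
    intro M
    obtain ⟨R, hR⟩ := hrad M
    refine ⟨R, fun s hs => hR _ (hs.trans ?_)⟩
    calc s ≤ |s| := le_abs_self s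
      _ = ‖(![s, (1 : ℝ)]) 0‖ := by simp [Real.norm_eq_abs]
      _ ≤ ‖![s, (1 : ℝ)]‖ := norm_le_pi_norm _ 0

/-- **Theorem 1.1 of Ahmadi–Krstić–Parrilo (2011), both halves.** The polynomial vector field
`ẋ = −x + xy`, `ẏ = −y` is globally asymptotically stable (every initial state has a global
solution, solutions are unique with `‖X t‖ ≤ ‖X 0‖e^{‖X 0‖}`, and every solution tends to `0`), yet
no real polynomial is a radially unbounded Lyapunov function with `V̇ ≤ 0` off the origin for it.
[cite: AhmadiKrsticParrilo2011, Thm 1.1] -/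
theorem theorem_1_1 :
    ((∀ z₀ : Fin 2 → ℝ, ∃ X : ℝ → Fin 2 → ℝ, X 0 = z₀ ∧
        ∀ T, ∀ t ∈ Icc 0 T, HasDerivWithinAt X (field (X t)) (Icc 0 T) t) ∧
      (∀ (X : ℝ → Fin 2 → ℝ) (T : ℝ), (∀ t ∈ Icc 0 T, HasDerivWithinAt X (field (X t)) (Icc 0 T) t) →
        ∀ t ∈ Icc 0 T, ‖X t‖ ≤ ‖X 0‖ * exp ‖X 0‖) ∧
      (∀ X : ℝ → Fin 2 → ℝ, (∀ T, ∀ t ∈ Icc 0 T, HasDerivWithinAt X (field (X t)) (Icc 0 T) t) →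
        Tendsto X atTop (𝓝 0))) ∧
    ¬ ∃ V : MvPolynomial (Fin 2) ℝ,
        (∀ M : ℝ, ∃ R : ℝ, ∀ z : Fin 2 → ℝ, R ≤ ‖z‖ → M ≤ eval z V) ∧
        (∀ z : Fin 2 → ℝ, z ≠ 0 → eval z (lieDeriv V) ≤ 0) :=
  ⟨globallyAsymptoticallyStable, fun ⟨V, hrad, hdec⟩ => no_polynomial_lyapunov_function V hrad hdec⟩

end AKP2011

end Literature.Analysis.ODE
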